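import Summits.BirchSwinnertonDyer.BirchSwinnertonDyer.Theorems.KolyvaginRoadThreeSchneiderTamAtThreeHeightLogNumeratorExactPCertData
import Summits.BirchSwinnertonDyer.BirchSwinnertonDyer.Theorems.KolyvaginRoadThreeSchneiderTamAtThreeHeightLogNumeratorExactPSplitChecker
import HarnessLib

/-!
# «The height is the logarithm of the numerator» — part 11b: core of the REGIME-FREE split checker
# (reduced truncated logarithm as a lemma; the split assembly with abstract proxies `T`, `c̃`, `ℓ̃og`)

HONEST FRAMING (cell `bsd-stepL`, seat `bsd-stepL-tam3-p2` g5; `--supports stmt-BirchSwinnertonDyer-19154 --as helper`):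
THEOREMS ONLY; 0 definitions, 0 named facts, 0 sorry; nothing class-wide; Schneider's conjecture and BSD asserted nowhere.
Route-free. Two reusable pieces of part 8c's split checker, abstracted from the `q`-digit proxies so that part 11c can feed
them the arbitrary-precision data of parts 10/11a:
* `norm_padicLog_intCast_sub_truncRed_le_padic` — **`‖log_p a − (p−1)⁻¹Σ_{n<N}(−1)ⁿAⁿ⁺¹/(n+1)‖ ≤ max(p^{−t}, (N+1)‖A‖^{N+1})`**
  for a `p`-unit integer `a` and ANY integer `A ≡ a^{p−1} − 1 (mod p^t)` with `p ∣ A` (part 6b′'s reduction, as a lemma);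
* `norm_padicLog_one_add_eq_padic` — `‖log_p(1 + B)‖ = ‖B‖` for `‖B‖ ≤ p⁻¹` (`p ≠ 2`);
* `norm_heightSplitCoord_sub_certTs_le_padic` — **the split assembly**: if `‖ĥ₄.₁(Q) − T‖ ≤ p^{−4k}`, `‖C⁻² − c̃‖ ≤ p^{−(2k+v)}`,
  `‖c̃‖ ≤ 1`, `‖log_p q‖ = p^{−v}`, `‖log_p q − ℓ̃og‖ ≤ p^{−(2k+2v)}`, `v ≤ 2k`, then
  `‖ĥ^{split}(Q) − (T − c̃·P₃(x⁻¹)/ℓ̃og)‖ ≤ p^{−4k}` (`P₃(t) = t − (b₂/12)t² + (b₂²/144 + c₄/240)t³`), for ANY `T, c̃, ℓ̃og ∈ ℚ_p`.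
References: [SteinWuthrich2013] §4.2; [Iwasawa1972PadicL] §4.4; [SilvermanATAEC1994] V.3.1; tree: parts 6b′, 8b, 8c, 11a.
-/

noncomputable section

open scoped Classical
open IsUltrametricDist
open WeierstrassCurve Literature.NumberTheory.EllipticCurves
open Literature.NumberTheory.EllipticCurves.SteinWuthrich2013
open Literature.NumberTheory.EllipticCurves.TateCurve
open Literature.NumberTheory.EllipticCurves.Rank1Residual
open Summit.BirchSwinnertonDyer.Uniform.UI.O2
open Summit.BirchSwinnertonDyer.Rank1Residual Summit.BirchSwinnertonDyer.Rank1Residual.X11b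
open Summit.BirchSwinnertonDyer.BirchSwinnertonDyer.Rank1Residual

namespace Summit.BirchSwinnertonDyer.Rank1Residual.X11b.RegMult.HeightLogNumerator

variable {p : ℕ} [hp : Fact p.Prime]

/-! ## The reduced truncated logarithm of a `p`-unit integer -/

/-- **`‖log_p a − (p−1)⁻¹·Σ_{n<N}(−1)ⁿAⁿ⁺¹/(n+1)‖ ≤ max(p^{−t}, (N+1)‖A‖^{N+1})`** for a `p`-unit integer `a` and any integer
`A` with `p^t ∣ a^{p−1} − 1 − A`, `p^α ∣ A`, `1 ≤ α` (`p ≠ 2`): `log_p a = (p−1)⁻¹ log_p(a^{p−1})`, `‖log_p(1+A₀) − log_p(1+A)‖ ≤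
‖A₀ − A‖`, and the truncated Mercator series at `A`. [cite: Iwasawa1972PadicL, §4.4] -/
theorem norm_padicLog_intCast_sub_truncRed_le_padic (hp2 : p ≠ 2) {a A : ℤ} {t α : ℕ} (N : ℕ) (hpa : ¬ (p : ℤ) ∣ a)
    (hA : (p : ℤ) ^ t ∣ a ^ (p - 1) - 1 - A) (hαA : (p : ℤ) ^ α ∣ A) (hα1 : 1 ≤ α) :
    ‖padicLog p (a : ℚ_[p]) - ((p : ℚ_[p]) - 1)⁻¹ *
        ∑ n ∈ Finset.range N, (-1) ^ n * ((A : ℚ_[p])) ^ (n + 1) / ((n : ℚ_[p]) + 1)‖ ≤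
      max ((p : ℝ) ^ (-(t : ℤ))) ((N + 1) * ‖(A : ℚ_[p])‖ ^ (N + 1)) := by
  have hpP : p.Prime := Fact.out
  have hp1 : (1 : ℝ) < p := by exact_mod_cast hpP.one_lt
  have hp1' : (1 : ℝ) ≤ p := hp1.le
  have han : ‖(a : ℚ_[p])‖ = 1 := BinaryQuartic.norm_intCast_eq_one hpa
  have ha0 : (a : ℚ_[p]) ≠ 0 := norm_pos_iff.mp (by rw [han]; exact one_pos)
  have hp1n : ‖((p : ℚ_[p]) - 1)‖ = 1 := by
    rw [show (p : ℚ_[p]) - 1 = ((p - 1 : ℕ) : ℚ_[p]) by rw [Nat.cast_sub hpP.one_le, Nat.cast_one]]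
    exact Padic.norm_natCast_eq_one_iff.mpr ((Nat.coprime_self_sub_right hpP.one_le).mpr (Nat.coprime_one_right _))
  have hAn : ‖(A : ℚ_[p])‖ ≤ (p : ℝ) ^ (-(α : ℤ)) := by exact_mod_cast (Padic.norm_int_le_pow_iff_dvd A α).mpr hαA
  have hAp : ‖(A : ℚ_[p])‖ ≤ (p : ℝ)⁻¹ := hAn.trans (by
    rw [← zpow_neg_one]
    exact zpow_le_zpow_right₀ hp1' (by omega))
  set A0 : ℚ_[p] := ((a : ℚ_[p])) ^ (p - 1) - 1 with hA0def
  have hA0int : A0 = ((a ^ (p - 1) - 1 : ℤ) : ℚ_[p]) := by rw [hA0def]; push_cast; ring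
  have hA0p : ‖A0‖ ≤ (p : ℝ)⁻¹ := by
    have hlt : ‖A0‖ < 1 := by
      rw [hA0def]; exact norm_pow_sub_one_lt_one_of_norm_eq_one han
    rw [hA0int] at hlt ⊢
    have hdvd : (p : ℤ) ∣ a ^ (p - 1) - 1 := Padic.norm_intCast_lt_one_iff.mp hlt
    have h := (Padic.norm_int_le_pow_iff_dvd (a ^ (p - 1) - 1) 1).mpr (by simpa using hdvd)
    simpa using h
  have hAA : ‖A0 - (A : ℚ_[p])‖ ≤ (p : ℝ) ^ (-(t : ℤ)) := by
    rw [hA0int, show (((a ^ (p - 1) - 1 : ℤ)) : ℚ_[p]) - (A : ℚ_[p]) = ((a ^ (p - 1) - 1 - A : ℤ) : ℚ_[p]) by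
      push_cast; ring]
    exact_mod_cast (Padic.norm_int_le_pow_iff_dvd (a ^ (p - 1) - 1 - A) t).mpr hA
  have hval : (a : ℚ_[p]).valuation = 0 := by
    have h := Padic.norm_eq_zpow_neg_valuation ha0
    rw [han] at h
    have h' : (p : ℝ) ^ (0 : ℤ) = (p : ℝ) ^ (-(a : ℚ_[p]).valuation) := by rw [zpow_zero]; exact h
    have := zpow_right_injective₀ (by positivity) hp1.ne' h'
    omega
  have h1A0 : (1 : ℚ_[p]) + A0 = ((a : ℚ_[p])) ^ (p - 1) := by rw [hA0def]; ring
  have hy1 : ‖1 - ((a : ℚ_[p])) ^ (p - 1)‖ < 1 := by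
    rw [norm_sub_rev]; exact norm_pow_sub_one_lt_one_of_norm_eq_one han
  have hloga : padicLog p (a : ℚ_[p]) = ((p : ℚ_[p]) - 1)⁻¹ * padicLog p (1 + A0) := by
    rw [h1A0, padicLog_eq_padicLogSeries hy1, padicLog_of_ne_zero ha0, hval, neg_zero, zpow_zero, mul_one]
  have hp1i : ‖((p : ℚ_[p]) - 1)⁻¹‖ = 1 := by rw [norm_inv, hp1n, inv_one]
  have htr := norm_padicLog_one_add_sub_sum_le_padic N hAp
  have hdl := norm_padicLog_one_add_sub_padicLog_one_add_le_padic hp2 hA0p hAp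
  rw [hloga, ← mul_sub, show padicLog p (1 + A0) -
      ∑ n ∈ Finset.range N, (-1) ^ n * ((A : ℚ_[p])) ^ (n + 1) / ((n : ℚ_[p]) + 1) =
      (padicLog p (1 + A0) - padicLog p (1 + (A : ℚ_[p]))) +
      (padicLog p (1 + (A : ℚ_[p])) - ∑ n ∈ Finset.range N, (-1) ^ n * ((A : ℚ_[p])) ^ (n + 1) / ((n : ℚ_[p]) + 1))
      by ring, norm_mul, hp1i, one_mul]
  exact (norm_add_le_max _ _).trans (max_le_max (hdl.trans hAA) htr)

/-- **`‖log_p(1 + B)‖ = ‖B‖`** for `‖B‖ ≤ p⁻¹`, `p ≠ 2` (`‖log_p(1+B) − B‖ ≤ 2‖B‖² < ‖B‖`). [cite: Iwasawa1972PadicL, §4.4] -/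
theorem norm_padicLog_one_add_eq_padic (hp2 : p ≠ 2) {B : ℚ_[p]} (hB : ‖B‖ ≤ (p : ℝ)⁻¹) :
    ‖padicLog p (1 + B)‖ = ‖B‖ := by
  have hpP : p.Prime := Fact.out
  have hp3 : (3 : ℝ) ≤ p := by
    have h3 : 3 ≤ p := by have := hpP.two_le; omega
    exact_mod_cast h3
  have hp0 : (0 : ℝ) < p := by positivity
  rcases eq_or_ne B 0 with hB0 | hB0
  · rw [hB0, add_zero, padicLog_one, norm_zero]
  have hBpos : 0 < ‖B‖ := norm_pos_iff.mpr hB0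
  have h1 := norm_padicLog_one_add_sub_sum_le_padic (p := p) 1 hB
  simp only [Finset.range_one, Finset.sum_singleton, pow_zero, one_mul, Nat.cast_zero, zero_add, div_one,
    pow_one] at h1
  have hlt : ‖padicLog p (1 + B) - B‖ < ‖B‖ := by
    refine h1.trans_lt ?_
    calc (((1 : ℕ) : ℝ) + 1) * ‖B‖ ^ (1 + 1) = (2 * ‖B‖) * ‖B‖ := by norm_num; ring
      _ ≤ (2 * (p : ℝ)⁻¹) * ‖B‖ := by gcongr
      _ < 1 * ‖B‖ := by
          refine mul_lt_mul_of_pos_right ?_ hBpos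
          rw [← div_eq_mul_inv, div_lt_one hp0]; linarith
      _ = ‖B‖ := one_mul _
  rw [show padicLog p (1 + B) = B + (padicLog p (1 + B) - B) by ring,
    norm_add_eq_max_of_norm_ne_norm hlt.ne', max_eq_left hlt.le]

/-! ## The split assembly with abstract proxies -/

set_option maxHeartbeats 800000 in
/-- **THE SPLIT ASSEMBLY (abstract proxies).** For a point `Q = (x, y)` of level `k` (`‖x‖ = p^{2k}`) on an integral model
(`‖b₂‖ ≤ 1`, `‖c₄‖ = 1` in `ℚ_p`, `p ≥ 5`) and ANY `T, c̃, ℓ̃og ∈ ℚ_p` with `‖ĥ₄.₁(Q) − T‖ ≤ p^{−4k}`, `‖C⁻² − c̃‖ ≤ p^{−(2k+v)}`,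
`‖c̃‖ ≤ 1`, `‖log_p q‖ = p^{−v}`, `‖log_p q − ℓ̃og‖ ≤ p^{−(2k+2v)}`, `1 ≤ k`, `v ≤ 2k`:
**`‖ĥ^{split}(Q) − (T − c̃·P₃(x⁻¹)/ℓ̃og)‖ ≤ p^{−4k}`**, `P₃(t) = t − (b₂/12)t² + (b₂²/144 + c₄/240)t³` (`ℓ² ≡ P₃(x⁻¹)` mod `x⁻³`,
part 8b). [cite: SteinWuthrich2013, §4.2] [cite: SilvermanATAEC1994, Thm. V.3.1] -/
theorem norm_heightSplitCoord_sub_certTs_le_padic (hp5 : 5 ≤ p) (W : WeierstrassCurve ℚ) [W.IsElliptic]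
    [W.IsGloballyMinimal] {q : ℚ_[p]} {x y : ℚ} (h : W.toAffine.Nonsingular x y) (hx1 : 1 < ‖(x : ℚ_[p])‖) {k v : ℕ}
    (hxinv : ‖(x : ℚ_[p])‖⁻¹ = (p : ℝ) ^ (-((2 * k : ℕ) : ℤ))) (hk : 1 ≤ k)
    (hb2n : ‖(W.baseChange ℚ_[p]).b₂‖ ≤ 1) (hc4n : ‖(W.baseChange ℚ_[p]).c₄‖ = 1)
    {T ct lg : ℚ_[p]} (hT : ‖heightFourOneCoord W p q x y - T‖ ≤ (p : ℝ) ^ (-((4 * k : ℕ) : ℤ)))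
    (hCct : ‖(uniformisationScaleSq W p q)⁻¹ - ct‖ ≤ (p : ℝ) ^ (-((2 * k + v : ℕ) : ℤ))) (hctn : ‖ct‖ ≤ 1)
    (hLq : ‖padicLog p q‖ = (p : ℝ) ^ (-(v : ℤ))) (hLl : ‖padicLog p q - lg‖ ≤ (p : ℝ) ^ (-((2 * k + 2 * v : ℕ) : ℤ)))
    (hv : v ≤ 2 * k) :
    ‖heightSplitCoord W p q x y - (T - ct * (((x : ℚ_[p]))⁻¹ - (W.baseChange ℚ_[p]).b₂ / 12 * ((x : ℚ_[p]))⁻¹ ^ 2 +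
        ((W.baseChange ℚ_[p]).b₂ ^ 2 / 144 + (W.baseChange ℚ_[p]).c₄ / 240) * ((x : ℚ_[p]))⁻¹ ^ 3) / lg)‖ ≤
      (p : ℝ) ^ (-((4 * k : ℕ) : ℤ)) := by
  have hpP : p.Prime := Fact.out
  have hp2 : p ≠ 2 := by omega
  have hp3 : p ≠ 3 := by omega
  have hp1 : (1 : ℝ) < p := by exact_mod_cast hpP.one_lt
  have hp1' : (1 : ℝ) ≤ p := hp1.le
  have hpR0 : (0 : ℝ) < p := by positivity
  set V := W.baseChange ℚ_[p] with hVdef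
  obtain ⟨hz, hz2⟩ := norm_neg_div_of_one_lt_norm (p := p) h hx1
  have heq : V.toAffine.Equation (x : ℚ_[p]) (y : ℚ_[p]) := (nonsingular_ratCast (p := p) h).left
  -- (1) `ℓ² ≈ P₃(x⁻¹)`
  set ℓ : ℚ_[p] := V.padicFormalLog (-(x : ℚ_[p]) / y) with hℓdef
  set P3 : ℚ_[p] := ((x : ℚ_[p]))⁻¹ - V.b₂ / 12 * ((x : ℚ_[p]))⁻¹ ^ 2 +
    (V.b₂ ^ 2 / 144 + V.c₄ / 240) * ((x : ℚ_[p]))⁻¹ ^ 3 with hP3def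
  have hℓP : ‖ℓ ^ 2 - P3‖ ≤ (p : ℝ) ^ (-((6 * k : ℕ) : ℤ)) := by
    have h1 := norm_formalLog_sq_sub_cubicProxy_le_padic V hp5 heq hx1 hz
    rw [hxinv] at h1
    refine h1.trans_eq ?_
    rw [← zpow_natCast, ← zpow_mul]; congr 1; push_cast; ring
  -- (2) norms of `log_p q`, `ℓ̃og` and their inverses
  have h22 : ((p : ℝ) ^ (-((2 * k + 2 * v : ℕ) : ℤ))) < (p : ℝ) ^ (-(v : ℤ)) :=
    zpow_lt_zpow_right₀ hp1 (by push_cast; omega)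
  have hLq0 : padicLog p q ≠ 0 := norm_pos_iff.mp (by rw [hLq]; positivity)
  have hlt : ‖padicLog p q - lg‖ < ‖padicLog p q‖ := by rw [hLq]; exact hLl.trans_lt h22
  have hlgn : ‖lg‖ = (p : ℝ) ^ (-(v : ℤ)) := by
    rw [← hLq, show lg = padicLog p q + -(padicLog p q - lg) by ring,
      norm_add_eq_max_of_norm_ne_norm (by rw [norm_neg]; exact hlt.ne'), norm_neg, max_eq_left hlt.le]
  have hlg0 : lg ≠ 0 := norm_pos_iff.mp (by rw [hlgn]; positivity)
  have hinvdiff : ‖(padicLog p q)⁻¹ - lg⁻¹‖ ≤ (p : ℝ) ^ (-((2 * k : ℕ) : ℤ)) := by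
    rw [inv_sub_inv hLq0 hlg0, norm_div, norm_mul, hLq, hlgn, norm_sub_rev, ← zpow_add₀ hpR0.ne']
    rw [div_le_iff₀ (by positivity)]
    refine hLl.trans ?_
    rw [← zpow_add₀ hpR0.ne']; apply le_of_eq; congr 1; push_cast; ring
  -- (3) `‖ℓ²‖ ≤ p^{−2k}`, `‖P₃‖ ≤ p^{−2k}`
  have hz1 : ‖-(x : ℚ_[p]) / y‖ ≤ 1 := hz.trans (inv_le_one_of_one_le₀ hp1')
  have hℓn : ‖ℓ‖ ≤ ‖-(x : ℚ_[p]) / y‖ := by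
    have hℓz : ‖ℓ - -(x : ℚ_[p]) / y‖ ≤ ‖-(x : ℚ_[p]) / y‖ ^ 2 := norm_padicFormalLog_sub_self_le_sq_padic V hp5 hz
    rw [show ℓ = (ℓ - -(x : ℚ_[p]) / y) + -(x : ℚ_[p]) / y by ring]
    refine (norm_add_le_max _ _).trans (max_le (hℓz.trans ?_) le_rfl)
    calc ‖-(x : ℚ_[p]) / y‖ ^ 2 = ‖-(x : ℚ_[p]) / y‖ * ‖-(x : ℚ_[p]) / y‖ := sq _
      _ ≤ 1 * ‖-(x : ℚ_[p]) / y‖ := by gcongr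
      _ = _ := one_mul _
  have hℓ2 : ‖ℓ ^ 2‖ ≤ (p : ℝ) ^ (-((2 * k : ℕ) : ℤ)) := by
    rw [norm_pow, ← hxinv, ← hz2]; exact pow_le_pow_left₀ (norm_nonneg _) hℓn 2
  have hunit : ∀ m : ℕ, Nat.Coprime p m → ‖((m : ℚ_[p]))⁻¹‖ = 1 := fun m hm => by
    rw [norm_inv, Padic.norm_natCast_eq_one_iff.mpr hm, inv_one]
  have hcop2 : Nat.Coprime p 2 := (Nat.coprime_primes hp.out Nat.prime_two).mpr hp2
  have hcop3 : Nat.Coprime p 3 := (Nat.coprime_primes hp.out Nat.prime_three).mpr hp3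
  have h12i : ‖(12 : ℚ_[p])⁻¹‖ = 1 := by
    have h12 : Nat.Coprime p 12 := by
      rw [show (12 : ℕ) = 2 ^ 2 * 3 by norm_num]; exact (Nat.Coprime.pow_right 2 hcop2).mul_right hcop3
    simpa using hunit 12 h12
  have h144i : ‖(144 : ℚ_[p])⁻¹‖ = 1 := by
    have h144 : Nat.Coprime p 144 := by
      rw [show (144 : ℕ) = 2 ^ 4 * 3 ^ 2 by norm_num]
      exact (Nat.Coprime.pow_right 4 hcop2).mul_right (Nat.Coprime.pow_right 2 hcop3)
    simpa using hunit 144 h144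
  have h240 : ‖(240 : ℚ_[p])⁻¹‖ ≤ p := by
    have h := norm_inv_smooth_le_padic hp5 4 1 1; norm_num at h; rw [norm_inv]; exact h
  have hXi : ‖((x : ℚ_[p]))⁻¹‖ = (p : ℝ) ^ (-((2 * k : ℕ) : ℤ)) := by rw [norm_inv, hxinv]
  have hp2k1 : (p : ℝ) ^ (-((2 * k : ℕ) : ℤ)) ≤ 1 := zpow_le_one_of_nonpos₀ hp1' (by simp)
  have hP3n : ‖P3‖ ≤ (p : ℝ) ^ (-((2 * k : ℕ) : ℤ)) := by
    rw [hP3def]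
    refine (norm_add_le_max _ _).trans (max_le ((norm_sub_le_max₃ _ _).trans (max_le hXi.le ?_)) ?_)
    · rw [norm_mul, div_eq_mul_inv, norm_mul, h12i, mul_one, norm_pow, hXi]
      calc ‖V.b₂‖ * ((p : ℝ) ^ (-((2 * k : ℕ) : ℤ))) ^ 2 ≤ 1 * ((p : ℝ) ^ (-((2 * k : ℕ) : ℤ))) ^ 2 := by
            gcongr
        _ = (p : ℝ) ^ (-((2 * k : ℕ) : ℤ)) * (p : ℝ) ^ (-((2 * k : ℕ) : ℤ)) := by ring
        _ ≤ (p : ℝ) ^ (-((2 * k : ℕ) : ℤ)) * 1 := by gcongr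
        _ = _ := mul_one _
    · rw [norm_mul, norm_pow, hXi]
      have hco : ‖V.b₂ ^ 2 / 144 + V.c₄ / 240‖ ≤ p := by
        refine (norm_add_le_max _ _).trans (max_le ?_ ?_)
        · rw [div_eq_mul_inv, norm_mul, h144i, mul_one, norm_pow]
          exact (pow_le_one₀ (norm_nonneg _) hb2n).trans hp1'
        · rw [div_eq_mul_inv, norm_mul, hc4n, one_mul]; exact h240
      have hpk : (p : ℝ) * (p : ℝ) ^ (-((2 * k : ℕ) : ℤ)) ≤ 1 := by
        rw [show (p : ℝ) * (p : ℝ) ^ (-((2 * k : ℕ) : ℤ)) = (p : ℝ) ^ (1 + -((2 * k : ℕ) : ℤ)) by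
          rw [zpow_add₀ hpR0.ne', zpow_one]]
        exact zpow_le_one_of_nonpos₀ hp1' (by push_cast; omega)
      calc ‖V.b₂ ^ 2 / 144 + V.c₄ / 240‖ * ((p : ℝ) ^ (-((2 * k : ℕ) : ℤ))) ^ 3
          ≤ p * ((p : ℝ) ^ (-((2 * k : ℕ) : ℤ))) ^ 3 := by gcongr
        _ = ((p : ℝ) * (p : ℝ) ^ (-((2 * k : ℕ) : ℤ))) * (p : ℝ) ^ (-((2 * k : ℕ) : ℤ)) *
              (p : ℝ) ^ (-((2 * k : ℕ) : ℤ)) := by ring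
        _ ≤ 1 * 1 * (p : ℝ) ^ (-((2 * k : ℕ) : ℤ)) := by gcongr
        _ = _ := by ring
  -- (4) the decomposition
  set C2 : ℚ_[p] := uniformisationScaleSq W p q with hC2def
  have hsplit : heightSplitCoord W p q x y = heightFourOneCoord W p q x y - C2⁻¹ * ℓ ^ 2 / padicLog p q := by
    rw [heightSplitCoord_eq_sub]
    show heightFourOneCoord W p q x y - ℓ ^ 2 / C2 / padicLog p q = _
    rw [div_eq_mul_inv (ℓ ^ 2) C2, mul_comm (ℓ ^ 2)]
  have hdec : heightSplitCoord W p q x y - (T - ct * P3 / lg) = (heightFourOneCoord W p q x y - T) -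
      ((C2⁻¹ - ct) * ℓ ^ 2 * (padicLog p q)⁻¹ + ct * (ℓ ^ 2 - P3) * (padicLog p q)⁻¹ +
        ct * P3 * ((padicLog p q)⁻¹ - lg⁻¹)) := by
    rw [hsplit, div_eq_mul_inv, div_eq_mul_inv]; ring
  have h4k : ((p : ℝ) ^ (-((2 * k : ℕ) : ℤ))) ^ 2 = (p : ℝ) ^ (-((4 * k : ℕ) : ℤ)) := by
    rw [← zpow_natCast, ← zpow_mul]; congr 1; push_cast; ring
  have hLqi : ‖(padicLog p q)⁻¹‖ = (p : ℝ) ^ (v : ℤ) := by rw [norm_inv, hLq, zpow_neg, inv_inv]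
  rw [hdec]
  refine (norm_sub_le_max₃ _ _).trans (max_le hT ((norm_add_le_max _ _).trans (max_le
    ((norm_add_le_max _ _).trans (max_le ?_ ?_)) ?_)))
  · rw [norm_mul, norm_mul, hLqi]
    calc ‖C2⁻¹ - ct‖ * ‖ℓ ^ 2‖ * (p : ℝ) ^ (v : ℤ)
        ≤ (p : ℝ) ^ (-((2 * k + v : ℕ) : ℤ)) * (p : ℝ) ^ (-((2 * k : ℕ) : ℤ)) * (p : ℝ) ^ (v : ℤ) := by gcongr
      _ = (p : ℝ) ^ (-((4 * k : ℕ) : ℤ)) := by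
          rw [← zpow_add₀ hpR0.ne', ← zpow_add₀ hpR0.ne']; congr 1; push_cast; ring
  · rw [norm_mul, norm_mul, hLqi]
    calc ‖ct‖ * ‖ℓ ^ 2 - P3‖ * (p : ℝ) ^ (v : ℤ) ≤ 1 * (p : ℝ) ^ (-((6 * k : ℕ) : ℤ)) * (p : ℝ) ^ (v : ℤ) := by
          gcongr
      _ = (p : ℝ) ^ (-((6 * k : ℕ) : ℤ) + (v : ℤ)) := by rw [one_mul, ← zpow_add₀ hpR0.ne']
      _ ≤ (p : ℝ) ^ (-((4 * k : ℕ) : ℤ)) := zpow_le_zpow_right₀ hp1' (by push_cast; omega)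
  · rw [norm_mul, norm_mul]
    calc ‖ct‖ * ‖P3‖ * ‖(padicLog p q)⁻¹ - lg⁻¹‖
        ≤ 1 * (p : ℝ) ^ (-((2 * k : ℕ) : ℤ)) * (p : ℝ) ^ (-((2 * k : ℕ) : ℤ)) := by gcongr
      _ = (p : ℝ) ^ (-((4 * k : ℕ) : ℤ)) := by rw [one_mul, ← sq, h4k]

end Summit.BirchSwinnertonDyer.Rank1Residual.X11b.RegMult.HeightLogNumerator

end
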